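/-
Copyright (c) 2026 the pub-hodgecm-mathlib formalisation cell (harness21).  Prover seat hodgecm-mathlib-K2Liu-p02 (g6), Track B «K2-LIT» ∕ hLiu418
#184♮, Road I v3 for #42F′, wave «IK-GLOB» (LEAD F0P6-plan (g13) RULINGS «M-155k» (2), «M-157q»; dealer K2E5-plan (g7)), letter (K-e)
«THE PARABOLIC CLAUSE IN THE κ-MODEL»: Kudla's Cayley mover and Li's `δ` differ by an explicit element of the Siegel parabolic `P_𝕐`.
-/
import Summits.HodgeConjecture.HodgeConjecture.Theorems.K2LiuSiegelMoverOriginValue        -- ★ origin values ∕ rational movers (g4)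
import Summits.HodgeConjecture.HodgeConjecture.Theorems.K2LiuDoubledDarbouxDeltaBlocks       -- ★ (K-d) re-enumeration bookkeeping
import Literature.NumberTheory.Weil1964.AdelicDoublingDiagonalLift                         -- ★ `coe_transportSp_apply_blocks`
import HarnessLib

/-!
# K2_Liu road (hLiu418 = stmt-HodgeConjecture-24832), wave «IK-GLOB», letter (K-e): `κ = p₀ · δ` with `p₀ ∈ P_𝕐` explicit, hence the parabolic
# clause of ★ `IsDoubledWeilRep` (phrased with Li's `δ`) holds VERBATIM in the Cayley-mover model of the Ikeda road

Cell `pub/hodgecm-mathlib` (D-0151), Track B, build stream 29.  The route's parabolic currency is Li's `δ` (★ `deltaD`, `rDelta = r_F^𝔻(δ)`,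
★ `IsDoubledWeilRep.parabolic : opD (rDelta · sD p · rDelta⁻¹) Φ 0 = χ(det_Δ p) · |det_Δ p|^{½} · Φ 0` for `p ∈ P_Δ(𝔸)`), while the Ikeda carrier `𝓡` of
Road I v3 (RULINGS M-155k (2), M-157q (r1)) is built on Kudla's Cayley mover `κ` (★ `cayleyMoverMatrix`, ★ `K2LiuCayleyMoverFin`).  Both carry the
diagonal Lagrangian `W^Δ` onto `𝕐`, so they differ by an element of `P_𝕐 = Stab(𝕐)`; ★ `K2LiuSiegelMoverOriginValue` (g4) proved that origin values
`(ω(r_F γ · q)Φ)(0)` only depend on `γ` modulo `P_𝕐(𝔸)` and flagged «NOT here: `κδ⁻¹ ∈ P_𝕐(F)`».  THIS FILE types it, explicitly and ring-generically,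
and draws the consequence the (E) step of IK-GLOB consumes:

* §1 (any commutative ring, any Gram `T` with `det T` a unit) `toBlocks₁₂_coe_inv` (`(A⁻¹)₁₂ = −(A₁₂)ᵀ` in `Sp_{2ι}`),
  **`transportSp_mem_siegelParabolicPi_of_toBlocks₁₂_eq_zero`** — a symplectic matrix with zero `(𝕏, 𝕐)`-block transports into `P_𝕐` (★ `siegelParabolicPi`);
* §2 (`2` invertible) **`cayleyMoverMatrix_eq_siegelMover_mul_deltaDiagMatrix : κ = p₀ · δ`** with
  `p₀ = ((1, 0; 0, ½), 0; (0, −½; −1, 0), (1, 0; 0, 2))` (a `low · levi` element: Levi `diag(1, ½)`, symmetric `c = (0, −1; −1, 0)`),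
  `coe_cayleyMover_mul_deltaDiag_inv` (`κ δ⁻¹ = p₀` in `Sp_{2(ι⊕ι)}`), `toBlocks₁₂_cayleyMover_mul_deltaDiag_inv` (`= 0`), and the `Fin (n + n)`
  re-enumeration `coe_cayleyFin_mul_deltaFin_inv`, `toBlocks₁₂_cayleyFin_mul_deltaFin_inv`;
* §3 (the doubled datum of ★ `DoubledUnitaryGlobalSplittingData`) **`ratSp_cayleyD_mul_deltaD_inv_mem_siegelParabolicPi`**: `ratSp (κ_n · δ⁻¹) ∈ P_𝕐(𝔸)`;
* §4 **`opD_conj_rFD_apply_zero_of_mem`** — THE PARABOLIC CLAUSE IN ANY `𝕐`-EQUIVALENT RATIONAL MOVER MODEL: for `sD` with ★ `IsDoubledWeilRep χ sD`, a rational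
  `γ` with `ratSp (γ δ⁻¹) ∈ P_𝕐(𝔸)`, and `p ∈ P_Δ(𝔸)` with `det_Δ p` a unit, `opD (r_F γ · sD p · (r_F γ)⁻¹) Φ 0 = χ(det_Δ p) · |det_Δ p|^{½} · Φ 0`;
  its κ-instance **`opD_cayley_conj_apply_zero`** (the clause the Ikeda carrier's big mover `ω(r_F(levi g₀ · κ))` meets).

No definition, no instance, no notation, no named-fact hypothesis, no `sorry`; axioms ⊆ {propext, Classical.choice, Quot.sound}.  HONEST LABEL: HC_CM is proved only
modulo the 7 printed citations (2 remaining named inputs: hLiu418 = stmt-HodgeConjecture-24832, h413 = stmt-HodgeConjecture-24833) until rung 0 closes; this file is a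
`--supports stmt-HodgeConjecture-24832` helper (wave IK-GLOB, letter (K-e)) and moves no counter.

References: [Kudla1994] S. S. Kudla, Israel J. Math. 87 (1994), §3 (the Cayley element of the doubled space); [Li1992] J.-S. Li, J. reine angew. Math. 428 (1992),
p. 181 (`δ`); [Weil1964] A. Weil, Acta Math. 111 (1964), Chap. I n° 13 p. 160 (`𝐫₀` on `P₀`), Chap. III n° 41 Thm 6 p. 193, n° 46 (42) p. 202;
[HarrisKudlaSweet1996] M. Harris, S. Kudla, W. J. Sweet, J. AMS 9 (1996), §1 (1.8); [GelbartRogawski1991] S. Gelbart, J. Rogawski, Invent. Math. 105 (1991), §3.1.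
-/

set_option autoImplicit false
set_option linter.dupNamespace false

noncomputable section

open scoped Matrix
open NumberField IsDedekindDomain

namespace Summit.HodgeConjecture.HodgeConjecture.Cruxes.HLiu418.K2LiuCayleyDeltaSiegelTransfer

open Literature.NumberTheory.Automorphic Literature.NumberTheory.Automorphic.UnitaryGroup
open Literature.RepresentationTheory.HeisenbergGroup Literature.RepresentationTheory.HeisenbergGroup.SymplecticMatrix
open Literature.NumberTheory.GelbartRogawski1991 Literature.NumberTheory.GelbartRogawski1991.GRConstruction
open Literature.NumberTheory.GelbartRogawski1991.UnitaryDualPair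
open Literature.NumberTheory.GelbartRogawski1991.UnitaryDualPair.LocalSplitting (reindex_sumCongr_mem_symplecticGroup)
open Literature.NumberTheory.Weil1964 Literature.NumberTheory.GaloisRepresentations
open Summit.HodgeConjecture.HodgeConjecture.Cruxes.HLiu418.K2LiuSiegelMoverOriginValue
  (omega_mul_apply_zero omega_ratThetaLiftCont_mul_apply_zero_of_mem)
open Summit.HodgeConjecture.HodgeConjecture.Cruxes.HLiu418.K2LiuDoubledDarbouxDeltaBlocks
  (reindex_sumCongr_fromBlocks reindex_mul_reindex toBlocks₁₂_map)
open Summit.HodgeConjecture.HodgeConjecture.Cruxes.HLiu418.K2LiuCayleyMoverFin (reindex_cayleyMoverMatrix_mem_symplecticGroup)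

/-! ## §1 Lower block-triangular symplectic matrices transport into `P_𝕐` -/

section Generic

variable {K : Type*} [CommRing K] {ι : Type*} [Fintype ι] [DecidableEq ι]

/-- **`(A⁻¹)₁₂ = −(A₁₂)ᵀ` in `Sp_{2ι}(K)`** (Mathlib: `A⁻¹ = −J Aᵀ J`). [cite: MoeglinVignerasWaldspurger1987, Chap. 2 II.2] -/
theorem toBlocks₁₂_coe_inv (A : Matrix.symplecticGroup ι K) :
    ((A⁻¹ : Matrix.symplecticGroup ι K) : Matrix (ι ⊕ ι) (ι ⊕ ι) K).toBlocks₁₂ = -((A : Matrix (ι ⊕ ι) (ι ⊕ ι) K).toBlocks₁₂)ᵀ := by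
  rw [SymplecticGroup.coe_inv]
  conv_lhs => rw [← Matrix.fromBlocks_toBlocks (A : Matrix (ι ⊕ ι) (ι ⊕ ι) K)]
  simp only [Matrix.J, Matrix.fromBlocks_transpose, Matrix.fromBlocks_neg, Matrix.fromBlocks_multiply, neg_zero, neg_neg, Matrix.zero_mul,
    Matrix.mul_zero, Matrix.one_mul, Matrix.mul_one, Matrix.neg_mul, Matrix.mul_neg, zero_add, add_zero, Matrix.toBlocks_fromBlocks₁₂]

variable (T : Matrix ι ι K) (hT : IsUnit T.det)

/-- **A SYMPLECTIC MATRIX WITH ZERO `(𝕏, 𝕐)`-BLOCK TRANSPORTS INTO THE SIEGEL PARABOLIC `P_𝕐`**: if `A₁₂ = 0` then `transportSp T A ∈ siegelParabolicPi T`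
(`(P⁻¹AP)(0, y) = (A₁₂ T y, …)`, ★ `coe_transportSp_apply_blocks`, and `(A⁻¹)₁₂ = −(A₁₂)ᵀ = 0` for the inverse). [cite: Weil1964, Chap. III n° 46 p. 201] -/
theorem transportSp_mem_siegelParabolicPi_of_toBlocks₁₂_eq_zero (A : Matrix.symplecticGroup ι K)
    (hA : (A : Matrix (ι ⊕ ι) (ι ⊕ ι) K).toBlocks₁₂ = 0) : transportSp T hT A ∈ siegelParabolicPi T := by
  refine ⟨fun y => ?_, fun y => ?_⟩
  · rw [coe_transportSp_apply_blocks, hA, Matrix.mulVec_zero, Matrix.zero_mulVec, zero_add]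
  · have h : ((transportSp T hT A : symplecticGroup (polar (Matrix.toLinearMap₂' K T))) :
          ((ι → K) × (ι → K)) ≃ₗ[K] ((ι → K) × (ι → K))).symm (0, y) =
        ((transportSp T hT A⁻¹ : symplecticGroup (polar (Matrix.toLinearMap₂' K T))) :
          ((ι → K) × (ι → K)) ≃ₗ[K] ((ι → K) × (ι → K))) (0, y) := by
      rw [map_inv]; rfl
    rw [h, coe_transportSp_apply_blocks, toBlocks₁₂_coe_inv, hA, Matrix.transpose_zero, neg_zero, Matrix.mulVec_zero, Matrix.zero_mulVec,
      zero_add]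

end Generic

/-! ## §2 `κ = p₀ · δ`: the Cayley mover is Li's `δ` followed by an explicit element of `P_𝕐` -/

section Cayley

/-- `−½ + 1 = ½` on matrices. [cite: Kudla1994, §3] -/
theorem neg_invOf_two_smul_one_add_one (K : Type*) [CommRing K] [Invertible (2 : K)] (ι : Type*) [DecidableEq ι] :
    -((⅟(2 : K)) • (1 : Matrix ι ι K)) + 1 = (⅟(2 : K)) • 1 := by
  rw [neg_add_eq_iff_eq_add, ← add_smul, ← two_mul, mul_invOf_self, one_smul]

/-- `1 − 2 = −1` on matrices. [cite: Kudla1994, §3] -/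
theorem one_add_neg_two_smul_one (K : Type*) [CommRing K] (ι : Type*) [DecidableEq ι] :
    (1 : Matrix ι ι K) + -((2 : K) • (1 : Matrix ι ι K)) = -1 := by
  rw [← sub_eq_add_neg, sub_eq_iff_eq_add, two_smul]
  abel

variable (K : Type*) [CommRing K] [Invertible (2 : K)] (ι : Type*) [Fintype ι] [DecidableEq ι]

/-- **`κ = p₀ · δ`** with `p₀ = ((1, 0; 0, ½), 0; (0, −½; −1, 0), (1, 0; 0, 2))` lower block-triangular (an element of `P_𝕐`: `low(c) · levi(diag(1, ½))`,
`c = (0, −1; −1, 0)`): Kudla's Cayley mover (★ `cayleyMoverMatrix`) is Li's `δ` (★ `deltaDiagMatrix`) followed by `p₀`. [cite: Kudla1994, §3] [cite: Li1992, p. 181] -/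
theorem cayleyMoverMatrix_eq_siegelMover_mul_deltaDiagMatrix :
    cayleyMoverMatrix K ι =
      Matrix.fromBlocks (Matrix.fromBlocks 1 0 0 ((⅟(2 : K)) • 1)) 0 (Matrix.fromBlocks 0 (-((⅟(2 : K)) • 1)) (-1) 0)
          (Matrix.fromBlocks 1 0 0 ((2 : K) • 1)) *
        deltaDiagMatrix K ι := by
  rw [cayleyMoverMatrix, deltaDiagMatrix]
  simp only [Matrix.fromBlocks_multiply, Matrix.fromBlocks_add, Matrix.zero_mul, Matrix.mul_zero, Matrix.mul_one, Matrix.mul_neg,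
    neg_zero, neg_neg, zero_add, add_zero, neg_invOf_two_smul_one_add_one, one_add_neg_two_smul_one]

/-- **`κ δ⁻¹ = p₀` in `Sp_{2(ι⊕ι)}(K)`**. [cite: Kudla1994, §3] [cite: Li1992, p. 181] -/
theorem coe_cayleyMover_mul_deltaDiag_inv :
    ((cayleyMover K ι * (deltaDiag K ι)⁻¹ : Matrix.symplecticGroup (ι ⊕ ι) K) : Matrix ((ι ⊕ ι) ⊕ (ι ⊕ ι)) ((ι ⊕ ι) ⊕ (ι ⊕ ι)) K) =
      Matrix.fromBlocks (Matrix.fromBlocks 1 0 0 ((⅟(2 : K)) • 1)) 0 (Matrix.fromBlocks 0 (-((⅟(2 : K)) • 1)) (-1) 0)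
        (Matrix.fromBlocks 1 0 0 ((2 : K) • 1)) := by
  rw [Submonoid.coe_mul, coe_cayleyMover, cayleyMoverMatrix_eq_siegelMover_mul_deltaDiagMatrix, Matrix.mul_assoc,
    show deltaDiagMatrix K ι = ((deltaDiag K ι : Matrix.symplecticGroup (ι ⊕ ι) K) : Matrix ((ι ⊕ ι) ⊕ (ι ⊕ ι)) ((ι ⊕ ι) ⊕ (ι ⊕ ι)) K) from rfl,
    ← Submonoid.coe_mul, mul_inv_cancel, Submonoid.coe_one, Matrix.mul_one]

/-- `(κ δ⁻¹)₁₂ = 0`. [cite: Kudla1994, §3] -/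
theorem toBlocks₁₂_cayleyMover_mul_deltaDiag_inv :
    ((cayleyMover K ι * (deltaDiag K ι)⁻¹ : Matrix.symplecticGroup (ι ⊕ ι) K) : Matrix ((ι ⊕ ι) ⊕ (ι ⊕ ι)) ((ι ⊕ ι) ⊕ (ι ⊕ ι)) K).toBlocks₁₂ = 0 := by
  rw [coe_cayleyMover_mul_deltaDiag_inv, Matrix.toBlocks_fromBlocks₁₂]

variable (n : ℕ)

/-- **the `Fin (n + n)` re-enumeration**: with `κ_n := reindex σ σ κ`, `δ_n := reindex σ σ δ` (`σ = e₂ ⊕ e₂`, the shapes of ★ `K2LiuCayleyMoverFin` and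
★ `deltaD`), `κ_n δ_n⁻¹ = reindex σ σ p₀`. [cite: Kudla1994, §3] [cite: Li1992, p. 181] -/
theorem coe_cayleyFin_mul_deltaFin_inv :
    (((⟨_, reindex_cayleyMoverMatrix_mem_symplecticGroup K n⟩ : Matrix.symplecticGroup (Fin (n + n)) K) *
          (⟨Matrix.reindex ((finSumFinEquiv (m := n) (n := n)).sumCongr (finSumFinEquiv (m := n) (n := n)))
              ((finSumFinEquiv (m := n) (n := n)).sumCongr (finSumFinEquiv (m := n) (n := n))) (deltaDiagMatrix K (Fin n)),
            reindex_sumCongr_mem_symplecticGroup _ K (deltaDiagMatrix_mem K (Fin n))⟩ : Matrix.symplecticGroup (Fin (n + n)) K)⁻¹ :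
          Matrix.symplecticGroup (Fin (n + n)) K) : Matrix (Fin (n + n) ⊕ Fin (n + n)) (Fin (n + n) ⊕ Fin (n + n)) K) =
      Matrix.reindex ((finSumFinEquiv (m := n) (n := n)).sumCongr (finSumFinEquiv (m := n) (n := n)))
        ((finSumFinEquiv (m := n) (n := n)).sumCongr (finSumFinEquiv (m := n) (n := n)))
        (Matrix.fromBlocks (Matrix.fromBlocks 1 0 0 ((⅟(2 : K)) • 1)) 0 (Matrix.fromBlocks 0 (-((⅟(2 : K)) • 1)) (-1) 0)
          (Matrix.fromBlocks 1 0 0 ((2 : K) • (1 : Matrix (Fin n) (Fin n) K)))) := by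
  have hp₀ : Matrix.fromBlocks (Matrix.fromBlocks 1 0 0 ((⅟(2 : K)) • 1)) 0 (Matrix.fromBlocks 0 (-((⅟(2 : K)) • 1)) (-1) 0)
      (Matrix.fromBlocks 1 0 0 ((2 : K) • (1 : Matrix (Fin n) (Fin n) K))) ∈ Matrix.symplecticGroup (Fin n ⊕ Fin n) K := by
    rw [← coe_cayleyMover_mul_deltaDiag_inv]
    exact SetLike.coe_mem _
  have hKD : (⟨_, reindex_cayleyMoverMatrix_mem_symplecticGroup K n⟩ : Matrix.symplecticGroup (Fin (n + n)) K) =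
      (⟨_, reindex_sumCongr_mem_symplecticGroup (finSumFinEquiv (m := n) (n := n)) K hp₀⟩ : Matrix.symplecticGroup (Fin (n + n)) K) *
        ⟨Matrix.reindex ((finSumFinEquiv (m := n) (n := n)).sumCongr (finSumFinEquiv (m := n) (n := n)))
            ((finSumFinEquiv (m := n) (n := n)).sumCongr (finSumFinEquiv (m := n) (n := n))) (deltaDiagMatrix K (Fin n)),
          reindex_sumCongr_mem_symplecticGroup _ K (deltaDiagMatrix_mem K (Fin n))⟩ :=
    Subtype.ext (by
      rw [Submonoid.coe_mul]
      show Matrix.reindex _ _ (cayleyMoverMatrix K (Fin n)) = Matrix.reindex _ _ _ * Matrix.reindex _ _ _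
      rw [reindex_mul_reindex, ← cayleyMoverMatrix_eq_siegelMover_mul_deltaDiagMatrix])
  rw [hKD, mul_inv_cancel_right]

/-- `(κ_n δ_n⁻¹)₁₂ = 0` on `Fin (n + n)`. [cite: Kudla1994, §3] -/
theorem toBlocks₁₂_cayleyFin_mul_deltaFin_inv :
    (((⟨_, reindex_cayleyMoverMatrix_mem_symplecticGroup K n⟩ : Matrix.symplecticGroup (Fin (n + n)) K) *
          (⟨Matrix.reindex ((finSumFinEquiv (m := n) (n := n)).sumCongr (finSumFinEquiv (m := n) (n := n)))
              ((finSumFinEquiv (m := n) (n := n)).sumCongr (finSumFinEquiv (m := n) (n := n))) (deltaDiagMatrix K (Fin n)),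
            reindex_sumCongr_mem_symplecticGroup _ K (deltaDiagMatrix_mem K (Fin n))⟩ : Matrix.symplecticGroup (Fin (n + n)) K)⁻¹ :
          Matrix.symplecticGroup (Fin (n + n)) K) : Matrix (Fin (n + n) ⊕ Fin (n + n)) (Fin (n + n) ⊕ Fin (n + n)) K).toBlocks₁₂ = 0 := by
  rw [coe_cayleyFin_mul_deltaFin_inv, reindex_sumCongr_fromBlocks, Matrix.toBlocks_fromBlocks₁₂, Matrix.reindex_apply, Matrix.submatrix_zero]
  rfl

end Cayley

/-! ## §3 At the doubled datum of record: `ratSp (κ_n δ⁻¹) ∈ P_𝕐(𝔸)` -/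

section Datum

variable (L : Type) [Field L] [NumberField L] [IsCMField L]
variable {N M n : ℕ} (e : Fin N × Fin M ≃ Fin n)
  (dV : Fin N → L) (hdV : ∀ i, IsCMField.complexConj L (dV i) = dV i) (hdV0 : ∀ i, dV i ≠ 0)
  (dW : Fin M → L) (hdW : ∀ i, IsCMField.complexConj L (dW i) = dW i) (hdW0 : ∀ i, dW i ≠ 0)

omit [NumberField L] [IsCMField L] in
/-- ★ `deltaD` is `δ_n` (the same matrix; membership proofs are irrelevant). [cite: Li1992, p. 181] -/
theorem deltaD_eq_mk : deltaD L (n := n) =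
    ⟨Matrix.reindex ((finSumFinEquiv (m := n) (n := n)).sumCongr (finSumFinEquiv (m := n) (n := n)))
        ((finSumFinEquiv (m := n) (n := n)).sumCongr (finSumFinEquiv (m := n) (n := n))) (deltaDiagMatrix (Fp L) (Fin n)),
      reindex_sumCongr_mem_symplecticGroup _ (Fp L) (deltaDiagMatrix_mem (Fp L) (Fin n))⟩ :=
  Subtype.ext rfl

/-- **`ratSp (κ_n · δ⁻¹) ∈ P_𝕐(𝔸)`** for the doubled datum (`T^𝔻 = gramDA`): the Cayley mover of the Ikeda road and the route's `δ` (★ `deltaD`) have the SAME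
origin-value calculus (★ `K2LiuSiegelMoverOriginValue.omega_ratThetaLiftCont_mul_apply_zero_of_mul_inv_mem`). [cite: Kudla1994, §3] [cite: Li1992, p. 181] -/
theorem ratSp_cayleyD_mul_deltaD_inv_mem_siegelParabolicPi :
    ratSp (Fp L) (gramDA L e dV hdV dW hdW) (isUnit_det_gramDA L e dV hdV hdV0 dW hdW hdW0)
        ((⟨_, reindex_cayleyMoverMatrix_mem_symplecticGroup (Fp L) n⟩ : Matrix.symplecticGroup (Fin (n + n)) (Fp L)) * (deltaD L)⁻¹) ∈
      siegelParabolicPi (gramDA L e dV hdV dW hdW) := by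
  rw [ratSp, MonoidHom.comp_apply]
  apply transportSp_mem_siegelParabolicPi_of_toBlocks₁₂_eq_zero
  rw [coe_mapHom, toBlocks₁₂_map, deltaD_eq_mk, toBlocks₁₂_cayleyFin_mul_deltaFin_inv, Matrix.map_zero _ (map_zero _)]

/-! ## §4 The parabolic clause of ★ `IsDoubledWeilRep` in any `𝕐`-equivalent rational mover model, and in the κ-model -/

set_option synthInstance.maxHeartbeats 400000 in
set_option maxHeartbeats 1600000 in
/-- **THE PARABOLIC CLAUSE IN ANY `𝕐`-EQUIVALENT RATIONAL MOVER MODEL.**  Let `sD` satisfy ★ `IsDoubledWeilRep χ sD`, let `γ ∈ Sp_{2(n+n)}(L⁺)` be a rational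
mover with `ratSp (γ δ⁻¹) ∈ P_𝕐(𝔸)` (e.g. `γ = δ`, or `γ = κ_n` by §3), and let `p ∈ P_Δ(𝔸)` (★ `IsSiegelDelta p`) with `det_Δ p` a unit.  Then
`(ω(r_F γ · sD p · (r_F γ)⁻¹)Φ)(0) = χ(det_Δ p) · |det_Δ p|^{½} · Φ(0)` for every `Φ ∈ 𝒮(𝔸_{L⁺}^{n+n})` — because
`r_F γ · sD p · (r_F γ)⁻¹ = r_F(γδ⁻¹) · (r_F δ · sD p · (r_F δ)⁻¹) · r_F(δγ⁻¹)` with both outer factors in `𝐫₀(P_𝕐(𝔸))` (Weil's `Θ`-rigidity), which fix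
origin values (★ `omega_ratThetaLiftCont_apply_zero_of_mem_siegelParabolicPi`). [cite: Weil1964, Chap. I n° 13 p. 160] [cite: Weil1964, Chap. III n° 41 Thm 6 p. 193]
[cite: HarrisKudlaSweet1996, §1 (1.8)] -/
theorem opD_conj_rFD_apply_zero_of_mem {χ : HeckeCharacter L} {sD : HA L e dV hdV dW hdW →* MpD L e dV hdV dW hdW}
    (hsD : IsDoubledWeilRep L e dV hdV hdV0 dW hdW hdW0 χ sD) (γ : Matrix.symplecticGroup (Fin (n + n)) (Fp L))
    (hγ : ratSp (Fp L) (gramDA L e dV hdV dW hdW) (isUnit_det_gramDA L e dV hdV hdV0 dW hdW hdW0) (γ * (deltaD L)⁻¹) ∈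
      siegelParabolicPi (gramDA L e dV hdV dW hdW))
    {p : HA L e dV hdV dW hdW} (hS : IsSiegelDelta L e dV hdV dW hdW p) (hu : IsUnit (detDelta L e dV hdV dW hdW p))
    (Φ : piSchwartzBruhat (Fp L) (Fin (n + n))) :
    opD L e dV hdV dW hdW (rFD L e dV hdV hdV0 dW hdW hdW0 γ * sD p * (rFD L e dV hdV hdV0 dW hdW hdW0 γ)⁻¹) Φ 0 =
      ((chiDet L e dV hdV dW hdW χ p : ℂˣ) : ℂ) * (modDelta L e dV hdV dW hdW p : ℂ) *
        (Φ : (Fin (n + n) → AdeleRing (𝓞 (Fp L)) (Fp L)) → ℂ) 0 := by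
  have e1 : rFD L e dV hdV hdV0 dW hdW hdW0 γ * sD p * (rFD L e dV hdV hdV0 dW hdW hdW0 γ)⁻¹ =
      rFD L e dV hdV hdV0 dW hdW hdW0 (γ * (deltaD L)⁻¹) *
        ((rFD L e dV hdV hdV0 dW hdW hdW0 (deltaD L) * sD p * (rFD L e dV hdV hdV0 dW hdW hdW0 (deltaD L))⁻¹) *
          rFD L e dV hdV hdV0 dW hdW hdW0 (deltaD L * γ⁻¹)) := by
    simp only [map_mul, map_inv, mul_assoc, inv_mul_cancel_left]
  have hγ' : ratSp (Fp L) (gramDA L e dV hdV dW hdW) (isUnit_det_gramDA L e dV hdV hdV0 dW hdW hdW0) (deltaD L * γ⁻¹) ∈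
      siegelParabolicPi (gramDA L e dV hdV dW hdW) := by
    rw [show deltaD L * γ⁻¹ = (γ * (deltaD L)⁻¹)⁻¹ by rw [mul_inv_rev, inv_inv], map_inv]
    exact Subgroup.inv_mem _ hγ
  have hA := omega_ratThetaLiftCont_mul_apply_zero_of_mem (isUnit_det_gramDA L e dV hdV hdV0 dW hdW hdW0) (γ * (deltaD L)⁻¹) hγ
    ((rFD L e dV hdV hdV0 dW hdW hdW0 (deltaD L) * sD p * (rFD L e dV hdV hdV0 dW hdW hdW0 (deltaD L))⁻¹) *
      rFD L e dV hdV hdV0 dW hdW hdW0 (deltaD L * γ⁻¹)) Φ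
  have hB := omega_mul_apply_zero (rFD L e dV hdV hdV0 dW hdW hdW0 (deltaD L) * sD p * (rFD L e dV hdV hdV0 dW hdW hdW0 (deltaD L))⁻¹)
    (rFD L e dV hdV hdV0 dW hdW hdW0 (deltaD L * γ⁻¹)) Φ
  have hC := hsD.parabolic p hS hu
    (adelicMpCont.omega (Fp L) (Fin (n + n)) (gramDA L e dV hdV dW hdW) (rFD L e dV hdV hdV0 dW hdW hdW0 (deltaD L * γ⁻¹)) Φ)
  have hD := omega_ratThetaLiftCont_apply_zero_of_mem_siegelParabolicPi (Fp L) (gramDA L e dV hdV dW hdW) (isUnit_det_gramDA L e dV hdV hdV0 dW hdW hdW0)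
    (deltaD L * γ⁻¹) hγ' Φ
  rw [e1]
  exact hA.trans (hB.trans (hC.trans (congrArg
    (fun t : ℂ => ((chiDet L e dV hdV dW hdW χ p : ℂˣ) : ℂ) * (modDelta L e dV hdV dW hdW p : ℂ) * t) hD)))

set_option synthInstance.maxHeartbeats 400000 in
set_option maxHeartbeats 1600000 in
/-- **THE PARABOLIC CLAUSE IN THE κ-MODEL** (the Ikeda road's mover, RULINGS M-155k (2) ∕ M-157q): for `p ∈ P_Δ(𝔸)` with `det_Δ p` a unit,
`(ω(r_F κ_n · sD p · (r_F κ_n)⁻¹)Φ)(0) = χ(det_Δ p) · |det_Δ p|^{½} · Φ(0)`. [cite: Kudla1994, §3] [cite: HarrisKudlaSweet1996, §1 (1.8)]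
[cite: Weil1964, Chap. III n° 41 Thm 6 p. 193] -/
theorem opD_cayley_conj_apply_zero {χ : HeckeCharacter L} {sD : HA L e dV hdV dW hdW →* MpD L e dV hdV dW hdW}
    (hsD : IsDoubledWeilRep L e dV hdV hdV0 dW hdW hdW0 χ sD)
    {p : HA L e dV hdV dW hdW} (hS : IsSiegelDelta L e dV hdV dW hdW p) (hu : IsUnit (detDelta L e dV hdV dW hdW p))
    (Φ : piSchwartzBruhat (Fp L) (Fin (n + n))) :
    opD L e dV hdV dW hdW
        (rFD L e dV hdV hdV0 dW hdW hdW0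
            (⟨_, reindex_cayleyMoverMatrix_mem_symplecticGroup (Fp L) n⟩ : Matrix.symplecticGroup (Fin (n + n)) (Fp L)) *
          sD p *
          (rFD L e dV hdV hdV0 dW hdW hdW0
            (⟨_, reindex_cayleyMoverMatrix_mem_symplecticGroup (Fp L) n⟩ : Matrix.symplecticGroup (Fin (n + n)) (Fp L)))⁻¹) Φ 0 =
      ((chiDet L e dV hdV dW hdW χ p : ℂˣ) : ℂ) * (modDelta L e dV hdV dW hdW p : ℂ) *
        (Φ : (Fin (n + n) → AdeleRing (𝓞 (Fp L)) (Fp L)) → ℂ) 0 :=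
  opD_conj_rFD_apply_zero_of_mem L e dV hdV hdV0 dW hdW hdW0 hsD _
    (ratSp_cayleyD_mul_deltaD_inv_mem_siegelParabolicPi L e dV hdV hdV0 dW hdW hdW0) hS hu Φ

end Datum

end Summit.HodgeConjecture.HodgeConjecture.Cruxes.HLiu418.K2LiuCayleyDeltaSiegelTransfer

end
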